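import Summits.QuantumAdvantage.QuantumAdvantage.Theorems.LightConeWindowHardA

/-! # LightConeWindowHardB — part 2/3 (mechanical split for landing of `LightConeWindowHard`; content verbatim; scopes re-opened with their variables) -/

set_option linter.dupNamespace false
set_option linter.style.longLine false

namespace Summit.QuantumAdvantage.AdviceFreeQNC0.LightConeWindowHard
open Finset Summit.QuantumAdvantage.AdviceFreeQNC0
open Literature.Computability.QuantumComplexity Literature.Computability.QuantumComplexity.RingHLF

section Uniform
variable {n : ℕ}

/-- LightConeWindowHardB helper `σU_val` (decomp-qadv land package; see the module docstring). -/
theorem σU_val (r k : ℕ) (hk : 3 * r + 3 ≤ k) (b : Fin (2 * k)) (hb : vU r _ b = true) :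
    (((b : ℕ) % 2 = 0 ∧ (b : ℕ) ≤ r) ∧ ((σU r k b : Fin _) : ℕ) = (b : ℕ) + (4 * r + 4)) ∨
    (((b : ℕ) % 2 = 0 ∧ 4 * r + 4 ≤ (b : ℕ) ∧ (b : ℕ) ≤ 5 * r + 4) ∧ ((σU r k b : Fin _) : ℕ) = (b : ℕ) - (4 * r + 4)) ∨
    (((b : ℕ) % 2 = 0 ∧ r + 1 ≤ (b : ℕ) ∧ (b : ℕ) ≤ 2 * r) ∧ ((σU r k b : Fin _) : ℕ) = 2 * k - (2 * r + 1 - (b : ℕ))) ∨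
    (((b : ℕ) % 2 = 1 ∧ 2 * k - r ≤ (b : ℕ)) ∧ ((σU r k b : Fin _) : ℕ) = (b : ℕ) + (2 * r + 1) - 2 * k) ∨
    (((b : ℕ) % 2 = 0 ∧ 2 * r + 2 ≤ (b : ℕ) ∧ (b : ℕ) ≤ 3 * r + 1) ∧ ((σU r k b : Fin _) : ℕ) = (b : ℕ) + (2 * r + 3)) ∨
    (((b : ℕ) % 2 = 1 ∧ 4 * r + 5 ≤ (b : ℕ) ∧ (b : ℕ) ≤ 5 * r + 4) ∧ ((σU r k b : Fin _) : ℕ) = (b : ℕ) - (2 * r + 3)) ∨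
    (((b : ℕ) = 3 * r + 2 + r % 2) ∧ ((σU r k b : Fin _) : ℕ) = 5 * r + 5) ∨
    (((b : ℕ) = 5 * r + 5) ∧ ((σU r k b : Fin _) : ℕ) = 3 * r + 2 + r % 2) ∨
    (((b : ℕ) % 2 = 0 ∧ 3 * r + 4 ≤ (b : ℕ) ∧ (b : ℕ) ≤ 4 * r + 2) ∧ ((σU r k b : Fin _) : ℕ) = 2 * k - (4 * r + 4 - (b : ℕ))) ∨
    (((b : ℕ) % 2 = 0 ∧ 2 * k - r ≤ (b : ℕ)) ∧ ((σU r k b : Fin _) : ℕ) = (b : ℕ) + (4 * r + 4) - 2 * k) ∨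
    ((5 * r + 6 ≤ (b : ℕ) ∧ (b : ℕ) + r + 2 ≤ 2 * k ∧ ((b : ℕ) + r) % 2 = 0) ∧ ((σU r k b : Fin _) : ℕ) = (b : ℕ) + 1) ∨
    ((5 * r + 7 ≤ (b : ℕ) ∧ (b : ℕ) + r + 1 ≤ 2 * k ∧ ((b : ℕ) + r) % 2 = 1) ∧ ((σU r k b : Fin _) : ℕ) = (b : ℕ) - 1) := by
  have hlt := b.isLt
  simp only [vU, decide_eq_true_eq] at hb
  simp only [σU, Fin.val_mk]
  generalize htt : (b : ℕ) = t at *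
  rcases VU_cases r k t hk hlt hb with hc | hc | hc | hc | hc | hc | hc | hc | hc | hc | hc | hc
  · have e : σUval r (2 * k) t = t + (4 * r + 4) := by
      unfold σUval
      rw [if_pos hc]
    rw [e]
    exact Or.inl ⟨hc, by omega⟩
  · have n1 : ¬(t % 2 = 0 ∧ t ≤ r) := by omega
    have e : σUval r (2 * k) t = t - (4 * r + 4) := by
      unfold σUval
      rw [if_neg n1, if_pos hc]
    rw [e]
    exact Or.inr (Or.inl ⟨hc, by omega⟩)
  · have n1 : ¬(t % 2 = 0 ∧ t ≤ r) := by omega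
    have n2 : ¬(t % 2 = 0 ∧ 4 * r + 4 ≤ t ∧ t ≤ 5 * r + 4) := by omega
    have e : σUval r (2 * k) t = 2 * k - (2 * r + 1 - t) := by
      unfold σUval
      rw [if_neg n1, if_neg n2, if_pos hc]
    rw [e]
    exact Or.inr (Or.inr (Or.inl ⟨hc, by omega⟩))
  · have n1 : ¬(t % 2 = 0 ∧ t ≤ r) := by omega
    have n2 : ¬(t % 2 = 0 ∧ 4 * r + 4 ≤ t ∧ t ≤ 5 * r + 4) := by omega
    have n3 : ¬(t % 2 = 0 ∧ r + 1 ≤ t ∧ t ≤ 2 * r) := by omega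
    have e : σUval r (2 * k) t = t + (2 * r + 1) - 2 * k := by
      unfold σUval
      rw [if_neg n1, if_neg n2, if_neg n3, if_pos hc]
    rw [e]
    exact Or.inr (Or.inr (Or.inr (Or.inl ⟨hc, by omega⟩)))
  · have n1 : ¬(t % 2 = 0 ∧ t ≤ r) := by omega
    have n2 : ¬(t % 2 = 0 ∧ 4 * r + 4 ≤ t ∧ t ≤ 5 * r + 4) := by omega
    have n3 : ¬(t % 2 = 0 ∧ r + 1 ≤ t ∧ t ≤ 2 * r) := by omega
    have n4 : ¬(t % 2 = 1 ∧ 2 * k - r ≤ t) := by omega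
    have e : σUval r (2 * k) t = t + (2 * r + 3) := by
      unfold σUval
      rw [if_neg n1, if_neg n2, if_neg n3, if_neg n4, if_pos hc]
    rw [e]
    exact Or.inr (Or.inr (Or.inr (Or.inr (Or.inl ⟨hc, by omega⟩))))
  · have n1 : ¬(t % 2 = 0 ∧ t ≤ r) := by omega
    have n2 : ¬(t % 2 = 0 ∧ 4 * r + 4 ≤ t ∧ t ≤ 5 * r + 4) := by omega
    have n3 : ¬(t % 2 = 0 ∧ r + 1 ≤ t ∧ t ≤ 2 * r) := by omega
    have n4 : ¬(t % 2 = 1 ∧ 2 * k - r ≤ t) := by omega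
    have n5 : ¬(t % 2 = 0 ∧ 2 * r + 2 ≤ t ∧ t ≤ 3 * r + 1) := by omega
    have e : σUval r (2 * k) t = t - (2 * r + 3) := by
      unfold σUval
      rw [if_neg n1, if_neg n2, if_neg n3, if_neg n4, if_neg n5, if_pos hc]
    rw [e]
    exact Or.inr (Or.inr (Or.inr (Or.inr (Or.inr (Or.inl ⟨hc, by omega⟩)))))
  · have n1 : ¬(t % 2 = 0 ∧ t ≤ r) := by omega
    have n2 : ¬(t % 2 = 0 ∧ 4 * r + 4 ≤ t ∧ t ≤ 5 * r + 4) := by omega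
    have n3 : ¬(t % 2 = 0 ∧ r + 1 ≤ t ∧ t ≤ 2 * r) := by omega
    have n4 : ¬(t % 2 = 1 ∧ 2 * k - r ≤ t) := by omega
    have n5 : ¬(t % 2 = 0 ∧ 2 * r + 2 ≤ t ∧ t ≤ 3 * r + 1) := by omega
    have n6 : ¬(t % 2 = 1 ∧ 4 * r + 5 ≤ t ∧ t ≤ 5 * r + 4) := by omega
    have e : σUval r (2 * k) t = 5 * r + 5 := by
      unfold σUval
      rw [if_neg n1, if_neg n2, if_neg n3, if_neg n4, if_neg n5, if_neg n6, if_pos hc]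
    rw [e]
    exact Or.inr (Or.inr (Or.inr (Or.inr (Or.inr (Or.inr (Or.inl ⟨hc, by omega⟩))))))
  · have n1 : ¬(t % 2 = 0 ∧ t ≤ r) := by omega
    have n2 : ¬(t % 2 = 0 ∧ 4 * r + 4 ≤ t ∧ t ≤ 5 * r + 4) := by omega
    have n3 : ¬(t % 2 = 0 ∧ r + 1 ≤ t ∧ t ≤ 2 * r) := by omega
    have n4 : ¬(t % 2 = 1 ∧ 2 * k - r ≤ t) := by omega
    have n5 : ¬(t % 2 = 0 ∧ 2 * r + 2 ≤ t ∧ t ≤ 3 * r + 1) := by omega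
    have n6 : ¬(t % 2 = 1 ∧ 4 * r + 5 ≤ t ∧ t ≤ 5 * r + 4) := by omega
    have n7 : ¬(t = 3 * r + 2 + r % 2) := by omega
    have e : σUval r (2 * k) t = 3 * r + 2 + r % 2 := by
      unfold σUval
      rw [if_neg n1, if_neg n2, if_neg n3, if_neg n4, if_neg n5, if_neg n6, if_neg n7, if_pos hc]
    rw [e]
    exact Or.inr (Or.inr (Or.inr (Or.inr (Or.inr (Or.inr (Or.inr (Or.inl ⟨hc, by omega⟩)))))))
  · have n1 : ¬(t % 2 = 0 ∧ t ≤ r) := by omega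
    have n2 : ¬(t % 2 = 0 ∧ 4 * r + 4 ≤ t ∧ t ≤ 5 * r + 4) := by omega
    have n3 : ¬(t % 2 = 0 ∧ r + 1 ≤ t ∧ t ≤ 2 * r) := by omega
    have n4 : ¬(t % 2 = 1 ∧ 2 * k - r ≤ t) := by omega
    have n5 : ¬(t % 2 = 0 ∧ 2 * r + 2 ≤ t ∧ t ≤ 3 * r + 1) := by omega
    have n6 : ¬(t % 2 = 1 ∧ 4 * r + 5 ≤ t ∧ t ≤ 5 * r + 4) := by omega
    have n7 : ¬(t = 3 * r + 2 + r % 2) := by omega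
    have n8 : ¬(t = 5 * r + 5) := by omega
    have e : σUval r (2 * k) t = 2 * k - (4 * r + 4 - t) := by
      unfold σUval
      rw [if_neg n1, if_neg n2, if_neg n3, if_neg n4, if_neg n5, if_neg n6, if_neg n7, if_neg n8, if_pos hc]
    rw [e]
    exact Or.inr (Or.inr (Or.inr (Or.inr (Or.inr (Or.inr (Or.inr (Or.inr (Or.inl ⟨hc, by omega⟩))))))))
  · have n1 : ¬(t % 2 = 0 ∧ t ≤ r) := by omega
    have n2 : ¬(t % 2 = 0 ∧ 4 * r + 4 ≤ t ∧ t ≤ 5 * r + 4) := by omega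
    have n3 : ¬(t % 2 = 0 ∧ r + 1 ≤ t ∧ t ≤ 2 * r) := by omega
    have n4 : ¬(t % 2 = 1 ∧ 2 * k - r ≤ t) := by omega
    have n5 : ¬(t % 2 = 0 ∧ 2 * r + 2 ≤ t ∧ t ≤ 3 * r + 1) := by omega
    have n6 : ¬(t % 2 = 1 ∧ 4 * r + 5 ≤ t ∧ t ≤ 5 * r + 4) := by omega
    have n7 : ¬(t = 3 * r + 2 + r % 2) := by omega
    have n8 : ¬(t = 5 * r + 5) := by omega
    have n9 : ¬(t % 2 = 0 ∧ 3 * r + 4 ≤ t ∧ t ≤ 4 * r + 2) := by omega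
    have e : σUval r (2 * k) t = t + (4 * r + 4) - 2 * k := by
      unfold σUval
      rw [if_neg n1, if_neg n2, if_neg n3, if_neg n4, if_neg n5, if_neg n6, if_neg n7, if_neg n8, if_neg n9, if_pos hc]
    rw [e]
    exact Or.inr (Or.inr (Or.inr (Or.inr (Or.inr (Or.inr (Or.inr (Or.inr (Or.inr (Or.inl ⟨hc, by omega⟩)))))))))
  · have n1 : ¬(t % 2 = 0 ∧ t ≤ r) := by omega
    have n2 : ¬(t % 2 = 0 ∧ 4 * r + 4 ≤ t ∧ t ≤ 5 * r + 4) := by omega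
    have n3 : ¬(t % 2 = 0 ∧ r + 1 ≤ t ∧ t ≤ 2 * r) := by omega
    have n4 : ¬(t % 2 = 1 ∧ 2 * k - r ≤ t) := by omega
    have n5 : ¬(t % 2 = 0 ∧ 2 * r + 2 ≤ t ∧ t ≤ 3 * r + 1) := by omega
    have n6 : ¬(t % 2 = 1 ∧ 4 * r + 5 ≤ t ∧ t ≤ 5 * r + 4) := by omega
    have n7 : ¬(t = 3 * r + 2 + r % 2) := by omega
    have n8 : ¬(t = 5 * r + 5) := by omega
    have n9 : ¬(t % 2 = 0 ∧ 3 * r + 4 ≤ t ∧ t ≤ 4 * r + 2) := by omega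
    have n10 : ¬(t % 2 = 0 ∧ 2 * k - r ≤ t) := by omega
    have e : σUval r (2 * k) t = t + 1 := by
      unfold σUval
      rw [if_neg n1, if_neg n2, if_neg n3, if_neg n4, if_neg n5, if_neg n6, if_neg n7, if_neg n8, if_neg n9, if_neg n10, if_pos hc]
    rw [e]
    exact Or.inr (Or.inr (Or.inr (Or.inr (Or.inr (Or.inr (Or.inr (Or.inr (Or.inr (Or.inr (Or.inl ⟨hc, by omega⟩))))))))))
  · have n1 : ¬(t % 2 = 0 ∧ t ≤ r) := by omega
    have n2 : ¬(t % 2 = 0 ∧ 4 * r + 4 ≤ t ∧ t ≤ 5 * r + 4) := by omega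
    have n3 : ¬(t % 2 = 0 ∧ r + 1 ≤ t ∧ t ≤ 2 * r) := by omega
    have n4 : ¬(t % 2 = 1 ∧ 2 * k - r ≤ t) := by omega
    have n5 : ¬(t % 2 = 0 ∧ 2 * r + 2 ≤ t ∧ t ≤ 3 * r + 1) := by omega
    have n6 : ¬(t % 2 = 1 ∧ 4 * r + 5 ≤ t ∧ t ≤ 5 * r + 4) := by omega
    have n7 : ¬(t = 3 * r + 2 + r % 2) := by omega
    have n8 : ¬(t = 5 * r + 5) := by omega
    have n9 : ¬(t % 2 = 0 ∧ 3 * r + 4 ≤ t ∧ t ≤ 4 * r + 2) := by omega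
    have n10 : ¬(t % 2 = 0 ∧ 2 * k - r ≤ t) := by omega
    have n11 : ¬(5 * r + 6 ≤ t ∧ t + r + 2 ≤ 2 * k ∧ (t + r) % 2 = 0) := by omega
    have e : σUval r (2 * k) t = t - 1 := by
      unfold σUval
      rw [if_neg n1, if_neg n2, if_neg n3, if_neg n4, if_neg n5, if_neg n6, if_neg n7, if_neg n8, if_neg n9, if_neg n10, if_neg n11, if_pos hc]
    rw [e]
    exact Or.inr (Or.inr (Or.inr (Or.inr (Or.inr (Or.inr (Or.inr (Or.inr (Or.inr (Or.inr (Or.inr (⟨hc, by omega⟩)))))))))))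

/-- LightConeWindowHardB helper `vU_σU` (decomp-qadv land package; see the module docstring). -/
theorem vU_σU (r k : ℕ) (hk : 3 * r + 3 ≤ k) (b : Fin (2 * k)) (hb : vU r _ b = true) : vU r _ (σU r k b) = true := by
  have h := σU_val r k hk b hb
  simp only [vU, decide_eq_true_eq]
  omega

set_option maxHeartbeats 4000000 in
/-- LightConeWindowHardB helper `window_σU` (decomp-qadv land package; see the module docstring). -/
theorem window_σU (r k : ℕ) (hk : 3 * r + 3 ≤ k) (b : Fin (2 * k)) (hb : vU r _ b = true) :
    window r (xU r _) (σU r k b) = window r (xU r _) b := by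
  have h := σU_val r k hk b hb
  have hlt := b.isLt
  funext d
  have hd := d.isLt
  rw [window_apply r (by omega), window_apply r (by omega)]
  simp only [xU, decide_eq_decide]
  generalize ((σU r k b : Fin _) : ℕ) = s at *
  generalize (d : ℕ) = dd at *
  generalize (b : ℕ) = t at *
  rcases h with ⟨hc, hs⟩ | ⟨hc, hs⟩ | ⟨hc, hs⟩ | ⟨hc, hs⟩ | ⟨hc, hs⟩ | ⟨hc, hs⟩ | ⟨hc, hs⟩ | ⟨hc, hs⟩ | ⟨hc, hs⟩ | ⟨hc, hs⟩ |
    ⟨hc, hs⟩ | ⟨hc, hs⟩ <;> (split_ifs <;> omega)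

/-- LightConeWindowHardB helper `σU_ne` (decomp-qadv land package; see the module docstring). -/
theorem σU_ne (r k : ℕ) (hk : 3 * r + 3 ≤ k) (b : Fin (2 * k)) (hb : vU r _ b = true) : σU r k b ≠ b := by
  have h := σU_val r k hk b hb
  intro he
  have h' := congrArg Fin.val he
  omega

/-- LightConeWindowHardB helper `σU_σU` (decomp-qadv land package; see the module docstring). -/
theorem σU_σU (r k : ℕ) (hk : 3 * r + 3 ≤ k) (b : Fin (2 * k)) (hb : vU r _ b = true) : σU r k (σU r k b) = b := by
  have h1 := σU_val r k hk b hb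
  have h2 := σU_val r k hk (σU r k b) (vU_σU r k hk b hb)
  apply Fin.ext
  omega

/-- ★★★ THE UNIFORM EVEN FAMILY: for every radius `r` and every even `n = 2k ≥ 6r+6`, every window-`(2r+1)` strategy loses on
the input with ones at `0, 2r+1, 4r+4`. -/
theorem xU_universalHard (r k : ℕ) (hk : 3 * r + 3 ≤ k) : UniversalHard r (xU r (2 * k)) :=
  universalHard_of_pairing r (xU r _) (vU r _) (σU r k) (oddZeros_xU r k hk) (inKernel_vU r k hk) (signBit_vU r k hk)
    (vU_σU r k hk) (window_σU r k hk) (σU_ne r k hk) (σU_σU r k hk)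

/-- The even half of the uniform rung, as a closed `Prop`. -/
def UniversalHardEvenAll : Prop := ∀ r n : ℕ, 6 * r + 6 ≤ n → n % 2 = 0 → ∃ x : Fin n → Bool, UniversalHard r x

/-- ★★★ PROVED, uniformly in `r`. -/
theorem universalHardEvenAll : UniversalHardEvenAll := by
  intro r n hn he
  obtain ⟨k, rfl⟩ : ∃ k, n = 2 * k := ⟨n / 2, by omega⟩
  exact ⟨xU r _, xU_universalHard r k (by omega)⟩

/-- The odd half (RESIDUAL of the uniform rung; data: six ones with gaps `(1, 2r+1, 1, 2r+3, 1, rest)` certify every odd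
`n ≥ 6r+9` for `r ≤ 6`, LIGHTCONE.md §4e). -/
def UniversalHardOddAll : Prop := ∀ r : ℕ, ∃ n₀ : ℕ, ∀ n ≥ n₀, n % 2 = 1 → ∃ x : Fin n → Bool, UniversalHard r x

/-- GLUED SPLIT of the uniform rung: `WindowSymHard3All` follows from the odd half alone (the even half is a theorem). -/
theorem windowSymHard3All_of_odd (hodd : UniversalHardOddAll) : WindowSymHard3All := by
  intro r
  obtain ⟨n₁, h₁⟩ := hodd r
  refine schemaClosesRung r ⟨max n₁ (6 * r + 6), fun n hn => ?_⟩
  rcases Nat.mod_two_eq_zero_or_one n with he | ho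
  · exact universalHardEvenAll r n (le_trans (le_max_right _ _) hn) he
  · exact h₁ n (le_trans (le_max_left _ _) hn) ho

end Uniform

/-! ## THE r-UNIFORM ODD FAMILY (PROVED): ones `{0, 1, 2r+2, 2r+3, 4r+6, 4r+7}` (gaps `1, 2r+1, 1, 2r+3, 1, rest`), every
odd `n ≥ 6r+9`, every radius `r`.  Kernel support `{even b ≤ 2r+2} ∪ {odd b ∈ [2r+3, 4r+5]} ∪ [4r+7, n)`, `e = n − 4r − 6`,
`w = 4`, sign bit 1, pairing `σUO` (24 linear branches).  With the even family this PROVES `WindowSymHard3All`. -/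

section UniformOdd

/-- Uniform odd family: ones at `0, 1, 2r+2, 2r+3, 4r+6, 4r+7`. -/
def xUO (r n : ℕ) : Fin n → Bool := fun j =>
  decide ((j : ℕ) = 0 ∨ (j : ℕ) = 1 ∨ (j : ℕ) = 2 * r + 2 ∨ (j : ℕ) = 2 * r + 3 ∨ (j : ℕ) = 4 * r + 6 ∨ (j : ℕ) = 4 * r + 7)
/-- Its kernel support. -/
abbrev VUO (r t : ℕ) : Prop := (t % 2 = 0 ∧ t ≤ 2 * r + 2) ∨ (t % 2 = 1 ∧ 2 * r + 3 ≤ t ∧ t ≤ 4 * r + 5) ∨ 4 * r + 7 ≤ t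
/-- LightConeWindowHardB helper `vUO` (decomp-qadv land package; see the module docstring). -/
def vUO (r n : ℕ) : Fin n → Bool := fun b => decide (VUO r b)
/-- The pairing (24 pairwise-disjoint linear branches; see LIGHTCONE.md §4e). -/
def σUOval (r n t : ℕ) : ℕ :=
  if t = 0 then 2 * r + 2
  else if t = 2 * r + 2 then 0
  else if t % 2 = 0 ∧ 2 ≤ t ∧ t ≤ r then t + (4 * r + 6)
  else if t % 2 = 0 ∧ 4 * r + 8 ≤ t ∧ t ≤ 5 * r + 6 then t - (4 * r + 6)
  else if r % 2 = 1 ∧ t = r + 1 then 5 * r + 7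
  else if r % 2 = 0 ∧ 2 ≤ r ∧ t = 3 * r + 3 then 5 * r + 7
  else if r % 2 = 1 ∧ t = 5 * r + 7 then r + 1
  else if r % 2 = 0 ∧ 2 ≤ r ∧ t = 5 * r + 7 then 3 * r + 3
  else if r % 2 = 0 ∧ 2 ≤ r ∧ t = r + 2 then n - r
  else if r % 2 = 1 ∧ t = 3 * r + 6 then n - r
  else if r % 2 = 0 ∧ 2 ≤ r ∧ t = n - r then r + 2
  else if r % 2 = 1 ∧ t = n - r then 3 * r + 6
  else if t % 2 = 0 ∧ r + 3 ≤ t ∧ t ≤ 2 * r then n - (2 * r + 2 - t)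
  else if t % 2 = 1 ∧ n - r + 1 ≤ t then t + (2 * r + 2) - n
  else if t = 2 * r + 3 then 4 * r + 7
  else if t = 4 * r + 7 then 2 * r + 3
  else if t % 2 = 1 ∧ 2 * r + 5 ≤ t ∧ t ≤ 3 * r + 2 then t + (2 * r + 4)
  else if t % 2 = 1 ∧ 4 * r + 9 ≤ t ∧ t ≤ 5 * r + 6 then t - (2 * r + 4)
  else if t = 3 * r + 5 - r % 2 then 5 * r + 8
  else if t = 5 * r + 8 then 3 * r + 5 - r % 2
  else if t % 2 = 1 ∧ 3 * r + 7 ≤ t ∧ t ≤ 4 * r + 5 then n - (4 * r + 6 - t)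
  else if t % 2 = 0 ∧ n - r + 1 ≤ t then t + (4 * r + 6) - n
  else if 5 * r + 9 ≤ t ∧ t + r + 2 ≤ n ∧ (t + r) % 2 = 1 then t + 1
  else if 5 * r + 10 ≤ t ∧ t + r + 1 ≤ n ∧ (t + r) % 2 = 0 then t - 1
  else t

/-- LightConeWindowHardB helper `σUO` (decomp-qadv land package; see the module docstring). -/
def σUO (r k : ℕ) : Fin (2 * k + 1) → Fin (2 * k + 1) := fun b => ⟨min (σUOval r (2 * k + 1) b) (2 * k), by omega⟩

/-- LightConeWindowHardB helper `VUO_cases` (decomp-qadv land package; see the module docstring). -/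
theorem VUO_cases (r k t : ℕ) (hk : 3 * r + 4 ≤ k) (ht : t < 2 * k + 1) (hV : VUO r t) :
    (t = 0) ∨
    (t = 2 * r + 2) ∨
    (t % 2 = 0 ∧ 2 ≤ t ∧ t ≤ r) ∨
    (t % 2 = 0 ∧ 4 * r + 8 ≤ t ∧ t ≤ 5 * r + 6) ∨
    (r % 2 = 1 ∧ t = r + 1) ∨
    (r % 2 = 0 ∧ 2 ≤ r ∧ t = 3 * r + 3) ∨
    (r % 2 = 1 ∧ t = 5 * r + 7) ∨
    (r % 2 = 0 ∧ 2 ≤ r ∧ t = 5 * r + 7) ∨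
    (r % 2 = 0 ∧ 2 ≤ r ∧ t = r + 2) ∨
    (r % 2 = 1 ∧ t = 3 * r + 6) ∨
    (r % 2 = 0 ∧ 2 ≤ r ∧ t = (2 * k + 1) - r) ∨
    (r % 2 = 1 ∧ t = (2 * k + 1) - r) ∨
    (t % 2 = 0 ∧ r + 3 ≤ t ∧ t ≤ 2 * r) ∨
    (t % 2 = 1 ∧ (2 * k + 1) - r + 1 ≤ t) ∨
    (t = 2 * r + 3) ∨
    (t = 4 * r + 7) ∨
    (t % 2 = 1 ∧ 2 * r + 5 ≤ t ∧ t ≤ 3 * r + 2) ∨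
    (t % 2 = 1 ∧ 4 * r + 9 ≤ t ∧ t ≤ 5 * r + 6) ∨
    (t = 3 * r + 5 - r % 2) ∨
    (t = 5 * r + 8) ∨
    (t % 2 = 1 ∧ 3 * r + 7 ≤ t ∧ t ≤ 4 * r + 5) ∨
    (t % 2 = 0 ∧ (2 * k + 1) - r + 1 ≤ t) ∨
    (5 * r + 9 ≤ t ∧ t + r + 2 ≤ (2 * k + 1) ∧ (t + r) % 2 = 1) ∨
    (5 * r + 10 ≤ t ∧ t + r + 1 ≤ (2 * k + 1) ∧ (t + r) % 2 = 0) := by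
  rcases hV with ⟨he, hle⟩ | ⟨ho, hge, hle⟩ | hge
  · by_cases h0 : t = 0
    · exact Or.inl h0
    by_cases h1 : t = 2 * r + 2
    · exact Or.inr (Or.inl h1)
    by_cases h2 : t ≤ r
    · exact Or.inr (Or.inr (Or.inl ⟨he, by omega, h2⟩))
    by_cases h3 : t ≤ r + 2
    · by_cases hr : r % 2 = 1
      · exact Or.inr (Or.inr (Or.inr (Or.inr (Or.inl ⟨hr, by omega⟩))))
      · exact Or.inr (Or.inr (Or.inr (Or.inr (Or.inr (Or.inr (Or.inr (Or.inr (Or.inl ⟨by omega, by omega, by omega⟩))))))))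
    · exact Or.inr (Or.inr (Or.inr (Or.inr (Or.inr (Or.inr (Or.inr (Or.inr (Or.inr (Or.inr (Or.inr (Or.inr (Or.inl ⟨he, by omega, by omega⟩))))))))))))
  · by_cases h0 : t = 2 * r + 3
    · exact Or.inr (Or.inr (Or.inr (Or.inr (Or.inr (Or.inr (Or.inr (Or.inr (Or.inr (Or.inr (Or.inr (Or.inr (Or.inr (Or.inr (Or.inl h0))))))))))))))
    by_cases h1 : t ≤ 3 * r + 2
    · exact Or.inr (Or.inr (Or.inr (Or.inr (Or.inr (Or.inr (Or.inr (Or.inr (Or.inr (Or.inr (Or.inr (Or.inr (Or.inr (Or.inr (Or.inr (Or.inr (Or.inl ⟨ho, by omega, h1⟩))))))))))))))))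
    by_cases h2 : t = 3 * r + 3
    · exact Or.inr (Or.inr (Or.inr (Or.inr (Or.inr (Or.inl ⟨by omega, by omega, h2⟩)))))
    by_cases h3 : t ≤ 3 * r + 5
    · exact Or.inr (Or.inr (Or.inr (Or.inr (Or.inr (Or.inr (Or.inr (Or.inr (Or.inr (Or.inr (Or.inr (Or.inr (Or.inr (Or.inr (Or.inr (Or.inr (Or.inr (Or.inr (Or.inl (by omega)))))))))))))))))))
    by_cases h4 : t = 3 * r + 6
    · exact Or.inr (Or.inr (Or.inr (Or.inr (Or.inr (Or.inr (Or.inr (Or.inr (Or.inr (Or.inl ⟨by omega, h4⟩)))))))))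
    · exact Or.inr (Or.inr (Or.inr (Or.inr (Or.inr (Or.inr (Or.inr (Or.inr (Or.inr (Or.inr (Or.inr (Or.inr (Or.inr (Or.inr (Or.inr (Or.inr (Or.inr (Or.inr (Or.inr (Or.inr (Or.inl ⟨ho, by omega, hle⟩))))))))))))))))))))
  · by_cases h0 : t = 4 * r + 7
    · exact Or.inr (Or.inr (Or.inr (Or.inr (Or.inr (Or.inr (Or.inr (Or.inr (Or.inr (Or.inr (Or.inr (Or.inr (Or.inr (Or.inr (Or.inr (Or.inl h0)))))))))))))))
    by_cases he : t % 2 = 0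
    · by_cases h1 : t ≤ 5 * r + 6
      · exact Or.inr (Or.inr (Or.inr (Or.inl ⟨he, by omega, h1⟩)))
      by_cases h2 : t = 5 * r + 7
      · exact Or.inr (Or.inr (Or.inr (Or.inr (Or.inr (Or.inr (Or.inl ⟨by omega, h2⟩))))))
      by_cases h3 : t = 5 * r + 8
      · exact Or.inr (Or.inr (Or.inr (Or.inr (Or.inr (Or.inr (Or.inr (Or.inr (Or.inr (Or.inr (Or.inr (Or.inr (Or.inr (Or.inr (Or.inr (Or.inr (Or.inr (Or.inr (Or.inr (Or.inl h3)))))))))))))))))))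
      by_cases h4 : t = (2 * k + 1) - r
      · exact Or.inr (Or.inr (Or.inr (Or.inr (Or.inr (Or.inr (Or.inr (Or.inr (Or.inr (Or.inr (Or.inr (Or.inl ⟨by omega, h4⟩)))))))))))
      by_cases h5 : (2 * k + 1) - r + 1 ≤ t
      · exact Or.inr (Or.inr (Or.inr (Or.inr (Or.inr (Or.inr (Or.inr (Or.inr (Or.inr (Or.inr (Or.inr (Or.inr (Or.inr (Or.inr (Or.inr (Or.inr (Or.inr (Or.inr (Or.inr (Or.inr (Or.inr (Or.inl ⟨he, h5⟩)))))))))))))))))))))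
      by_cases h6 : (t + r) % 2 = 1
      · exact Or.inr (Or.inr (Or.inr (Or.inr (Or.inr (Or.inr (Or.inr (Or.inr (Or.inr (Or.inr (Or.inr (Or.inr (Or.inr (Or.inr (Or.inr (Or.inr (Or.inr (Or.inr (Or.inr (Or.inr (Or.inr (Or.inr (Or.inl ⟨by omega, by omega, h6⟩))))))))))))))))))))))
      · exact Or.inr (Or.inr (Or.inr (Or.inr (Or.inr (Or.inr (Or.inr (Or.inr (Or.inr (Or.inr (Or.inr (Or.inr (Or.inr (Or.inr (Or.inr (Or.inr (Or.inr (Or.inr (Or.inr (Or.inr (Or.inr (Or.inr (Or.inr (⟨by omega, by omega, by omega⟩)))))))))))))))))))))))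
    · by_cases h1 : t ≤ 5 * r + 6
      · exact Or.inr (Or.inr (Or.inr (Or.inr (Or.inr (Or.inr (Or.inr (Or.inr (Or.inr (Or.inr (Or.inr (Or.inr (Or.inr (Or.inr (Or.inr (Or.inr (Or.inr (Or.inl ⟨by omega, by omega, h1⟩)))))))))))))))))
      by_cases h2 : t = 5 * r + 7
      · exact Or.inr (Or.inr (Or.inr (Or.inr (Or.inr (Or.inr (Or.inr (Or.inl ⟨by omega, by omega, h2⟩)))))))
      by_cases h3 : t = 5 * r + 8
      · exact Or.inr (Or.inr (Or.inr (Or.inr (Or.inr (Or.inr (Or.inr (Or.inr (Or.inr (Or.inr (Or.inr (Or.inr (Or.inr (Or.inr (Or.inr (Or.inr (Or.inr (Or.inr (Or.inr (Or.inl h3)))))))))))))))))))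
      by_cases h4 : t = (2 * k + 1) - r
      · exact Or.inr (Or.inr (Or.inr (Or.inr (Or.inr (Or.inr (Or.inr (Or.inr (Or.inr (Or.inr (Or.inl ⟨by omega, by omega, h4⟩))))))))))
      by_cases h5 : (2 * k + 1) - r + 1 ≤ t
      · exact Or.inr (Or.inr (Or.inr (Or.inr (Or.inr (Or.inr (Or.inr (Or.inr (Or.inr (Or.inr (Or.inr (Or.inr (Or.inr (Or.inl ⟨by omega, h5⟩)))))))))))))
      by_cases h6 : (t + r) % 2 = 1
      · exact Or.inr (Or.inr (Or.inr (Or.inr (Or.inr (Or.inr (Or.inr (Or.inr (Or.inr (Or.inr (Or.inr (Or.inr (Or.inr (Or.inr (Or.inr (Or.inr (Or.inr (Or.inr (Or.inr (Or.inr (Or.inr (Or.inr (Or.inl ⟨by omega, by omega, h6⟩))))))))))))))))))))))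
      · exact Or.inr (Or.inr (Or.inr (Or.inr (Or.inr (Or.inr (Or.inr (Or.inr (Or.inr (Or.inr (Or.inr (Or.inr (Or.inr (Or.inr (Or.inr (Or.inr (Or.inr (Or.inr (Or.inr (Or.inr (Or.inr (Or.inr (Or.inr (⟨by omega, by omega, by omega⟩)))))))))))))))))))))))


end UniformOdd
end Summit.QuantumAdvantage.AdviceFreeQNC0.LightConeWindowHard
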